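import Summits.CriticalPhenomena.CardyFormulaZ2.Theses.CardyAnchoredRigidity
import Summits.CriticalPhenomena.CardyFormulaZ2.Theses.CardyLocalRigidity

/-!
# Birth skeleton `Lines/birth.lean` for crux `ClusterSetConnected` (stmt-CriticalPhenomena-5769)

Route `route-CriticalPhenomena-CardyAnchoredRigidity` (the crux is SHARED verbatim with
`route-CriticalPhenomena-CardyLocalRigidity`), sub-problem `CardyFormulaZ2`, crux decl
`Summit.CriticalPhenomena.CardyFormulaZ2.Theses.CardyAnchoredRigidity.ClusterSetConnected`:

  the cluster set `Λ' = {g | g is a cluster point, as δ → 0⁺, of δ ↦ (R ↦ bondDomainCrossingProb R δ)}`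
  is preconnected in the product space `ConformalRectangle → ℝ`.

This is the route's own "intended proof" cut into its two genuine lemmas (BC3 skeleton, planner
`skel-stmt-CriticalPhenomena-5769`, 2026-08-17):

* `stub_scaleContinuity` (S1, PERCOLATION, the load-bearing input; size L): asymptotic continuity of
  every crossing probability in the logarithmic scale of the mesh — for every conformal rectangle `R`
  and `ε > 0` there are `θ > 0`, `δ₀ > 0` with `|p_R(δ') − p_R(δ)| < ε` whenever
  `0 < δ ≤ δ' < δ₀`, `δ' ≤ (1+θ)δ`. This is VERBATIM the typed support item
  `CardyLocalRigidity.ScaleContinuity` (stmt-CriticalPhenomena-5770; grounded "known in print modulo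
  G02's discretisation": Schramm–Smirnov 2011 Lemma 6.1 + the lattice dilation identity
  `p_R(δ/λ) = p_{λR}(δ)`; RSW + half-plane 3-arm bounds near the marks), so a proof of that item
  discharges this stub by `Iff.rfl` (checked in the planner's scratch file `bc/scale_iff.lean`).
* `stub_clusterSetPreconnected` (S2, TOPOLOGY, model-free; size M): the product-uniformity form of
  "the ω-limit set of a precompact, asymptotically continuous path is connected" (Hale 2010,
  Lemma 3.1.1/3.1.2 is the continuous-semiflow version): for ANY index type `ι`, a path
  `p : ℝ → (ι → ℝ)` with values in a compact set for `δ > 0` and coordinatewise log-asymptotically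
  continuous at `0⁺` has a preconnected cluster set at `𝓝[>] 0`. Proof on paper: `Λ` is closed in the
  compact `K`, so a separation `Λ = A ⊔ B` is by disjoint compacts; `Disjoint.exists_uniform_thickening`
  in the Pi uniformity gives a basic entourage `W_{F,ε}` (finitely many coordinates `F`) whose
  thickenings `U ⊇ A`, `V ⊇ B` are `W_{F,ε/2}`-apart; `IsCompact.compl_mem_sets` on `K \ (U ∪ V)`
  confines `p δ` to `U ∪ V` for small `δ`; both `U` and `V` are visited at arbitrarily small meshes
  (cluster points in `A` and in `B`), and at the infimum of the `U`-visits inside one excursion the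
  `(θ, δ₀)`-continuity of the finitely many coordinates in `F` is violated — contradiction.

The composition `ClusterSetConnected_of` instantiates S2 at `ι := ConformalRectangle`,
`p δ R := bondDomainCrossingProb R δ`, `K := [0,1]^ConformalRectangle` (Tychonoff;
`bondDomainCrossingProb_mem_Icc`) and feeds it S1; its conclusion is literally the route decl
`…Theses.CardyAnchoredRigidity.ClusterSetConnected`. The item is SHARED (one statement, two route
files): `…Theses.CardyLocalRigidity.ClusterSetConnected` is the same term (`crux_shared_iff : _ ↔ _ :=
Iff.rfl` below), and the registry's skeleton theorem `ClusterSetConnected_proof` concludes that default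
decl from the same composition applied to the two (sorried) stubs. No `sorry` outside the two `stub_*`.

Disproof used: none (no `Disproof.lean` on this crux at registration time; `ledger crux ls` empty).
Negatives index: no refuted statement of the summit concerns cluster sets or scale continuity
(stmt-0748's refutation only certifies the frame is not junk-refutable by degenerate arcs).
-/

open Filter Topology Set

namespace Summit.CriticalPhenomena.CardyFormulaZ2.Cruxes.ClusterSetConnected.Birth

open Literature.Probability.RandomPlanarGeometry Literature.Probability.Percolation

/-! ### The two statements of the line -/

/-- **S1 — scale continuity of the bond-ℤ² crossing probabilities (percolation input, size L).**
For every conformal rectangle `R` and `ε > 0` there are `θ > 0` and `δ₀ > 0` such that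
`|bondDomainCrossingProb R δ' − bondDomainCrossingProb R δ| < ε` whenever `0 < δ ≤ δ' < δ₀` and
`δ' ≤ (1 + θ) δ`. Verbatim the support item `CardyLocalRigidity.ScaleContinuity`
(stmt-CriticalPhenomena-5770). Sources: Schramm–Smirnov, Ann. Probab. 39 (2011) Lemma 6.1
(arXiv:1101.5820); Garban–Pete–Schramm 2013 (pivotal measures, §2 quads); Nolin 2008 (arm
exponents near the boundary); Grimmett 1999 §9.7, §11 (RSW on ℤ²). -/
def ScaleContinuity : Prop :=
  ∀ (R : ConformalRectangle) (ε : ℝ), 0 < ε → ∃ θ > (0 : ℝ), ∃ δ₀ > (0 : ℝ), ∀ δ δ' : ℝ,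
    0 < δ → δ ≤ δ' → δ' < δ₀ → δ' ≤ (1 + θ) * δ →
      |bondDomainCrossingProb R δ' - bondDomainCrossingProb R δ| < ε

/-- **S2 — the cluster set of a precompact, coordinatewise log-asymptotically continuous path in a
product of lines is preconnected (topology, model-free, size M).** For any index type `ι`, any
path `p : ℝ → (ι → ℝ)` taking values in a compact set `K` at positive times, if every coordinate
`δ ↦ p δ i` is asymptotically continuous in `log δ` at `0⁺` (the `(θ, δ₀)`-form of S1), then
`{g | MapClusterPt g (𝓝[>] 0) p}` is preconnected in the product topology. Product-uniformity form
of Hale (2010), *Asymptotic Behavior of Dissipative Systems*, Lemma 3.1.1 (ω-limit sets of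
precompact orbits of continuous semiflows are connected); here continuity of the path is replaced
by vanishing jumps, which is what a lattice path `δ ↦ p(δ)` (a step function of the mesh) has. -/
def ClusterSetPreconnected : Prop :=
  ∀ (ι : Type) (p : ℝ → ι → ℝ) (K : Set (ι → ℝ)), IsCompact K → (∀ δ : ℝ, 0 < δ → p δ ∈ K) →
    (∀ (i : ι) (ε : ℝ), 0 < ε → ∃ θ > (0 : ℝ), ∃ δ₀ > (0 : ℝ), ∀ δ δ' : ℝ,
      0 < δ → δ ≤ δ' → δ' < δ₀ → δ' ≤ (1 + θ) * δ → |p δ' i - p δ i| < ε) →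
    IsPreconnected {g : ι → ℝ | MapClusterPt g (𝓝[>] (0 : ℝ)) p}

/-! ### Registered stubs (the ONLY sorries of this file) -/

/-- **stub_scaleContinuity** (S1, size L; the load-bearing percolation input — RSW + boundary
three-arm control of `p_{λR}(δ) − p_R(δ)` for `λ ∈ [1, 1+θ]`, uniformly in `δ < δ₀`, for EVERY
Jordan conformal rectangle under G02's discretisation). See `ScaleContinuity`. -/
theorem stub_scaleContinuity : ScaleContinuity := by
  sorry

/-- **stub_clusterSetPreconnected** (S2, size M; pure point-set topology in the Pi uniformity of
`ι → ℝ`: `isClosed_setOf_clusterPt`, `Disjoint.exists_uniform_thickening`, the finite-coordinate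
basis of `𝓤 (ι → ℝ)`, `IsCompact.compl_mem_sets`, and an infimum argument on one excursion).
See `ClusterSetPreconnected`. -/
theorem stub_clusterSetPreconnected : ClusterSetPreconnected := by
  sorry

/-! ### Name-keyed aliases of the two statements

The hypotheses of the composition: the skeleton audit admits a hypothesis only if its head
constant is a registered obligation or is named like a declared stub. -/
namespace Registered

/-- Alias of `ScaleContinuity` keyed by the registered stub name. -/
abbrev stub_scaleContinuity : Prop := ScaleContinuity

/-- Alias of `ClusterSetPreconnected` keyed by the registered stub name. -/
abbrev stub_clusterSetPreconnected : Prop := ClusterSetPreconnected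

end Registered

/-! ### The composition: the two stubs imply the crux, by name (no `sorry`) -/

/-- **`ClusterSetConnected` from the two stubs.** Instantiate the topological lemma S2 at
`ι := ConformalRectangle`, `p δ R := bondDomainCrossingProb R δ`, the compact box
`K := [0,1]^ConformalRectangle` (Tychonoff `isCompact_univ_pi`; membership by
`bondDomainCrossingProb_mem_Icc`), and feed it the percolation input S1 coordinate by coordinate.
The conclusion is literally the route declaration (`𝓝[>] 0` is `nhdsWithin 0 (Set.Ioi 0)`). -/
theorem ClusterSetConnected_of (h₁ : Registered.stub_scaleContinuity)
    (h₂ : Registered.stub_clusterSetPreconnected) :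
    Summit.CriticalPhenomena.CardyFormulaZ2.Theses.CardyAnchoredRigidity.ClusterSetConnected := by
  -- the compact box [0,1]^ConformalRectangle containing every crossing function
  have hK : IsCompact (Set.pi Set.univ (fun _ : ConformalRectangle => Set.Icc (0 : ℝ) 1)) :=
    isCompact_univ_pi fun _ => isCompact_Icc
  have hPK : ∀ δ : ℝ, 0 < δ →
      (fun R : ConformalRectangle => bondDomainCrossingProb R δ) ∈
        Set.pi Set.univ (fun _ : ConformalRectangle => Set.Icc (0 : ℝ) 1) :=
    fun δ _ => Set.mem_univ_pi.2 fun R => bondDomainCrossingProb_mem_Icc R δ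
  -- S2 at the crossing-function path, fed by S1 coordinatewise
  exact h₂ ConformalRectangle (fun (δ : ℝ) (R : ConformalRectangle) => bondDomainCrossingProb R δ)
    (Set.pi Set.univ (fun _ : ConformalRectangle => Set.Icc (0 : ℝ) 1)) hK hPK
    (fun R ε hε => h₁ R ε hε)

/-- The crux is ONE shared item (stmt-CriticalPhenomena-5769) rendered in two route files: the two
declarations are the same term. -/
theorem crux_shared_iff :
    Summit.CriticalPhenomena.CardyFormulaZ2.Theses.CardyAnchoredRigidity.ClusterSetConnected ↔
      Summit.CriticalPhenomena.CardyFormulaZ2.Theses.CardyLocalRigidity.ClusterSetConnected :=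
  Iff.rfl

/-- **Skeleton theorem** (registry shape `<Crux>_proof : <crux decl> := <line>_of stub₁ … stub_k`):
the crux — under the item's default decl name `CardyLocalRigidity.ClusterSetConnected`, definitionally
the `CardyAnchoredRigidity` one — from the two registered (sorried) stubs through
`ClusterSetConnected_of`. It becomes the crux proof when the last stub is discharged; it contains no
`sorry` of its own. -/
theorem ClusterSetConnected_proof :
    Summit.CriticalPhenomena.CardyFormulaZ2.Theses.CardyLocalRigidity.ClusterSetConnected :=
  ClusterSetConnected_of stub_scaleContinuity stub_clusterSetPreconnected

/-- Wiring check under this route's own decl name. -/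
example : Summit.CriticalPhenomena.CardyFormulaZ2.Theses.CardyAnchoredRigidity.ClusterSetConnected :=
  ClusterSetConnected_of stub_scaleContinuity stub_clusterSetPreconnected

end Summit.CriticalPhenomena.CardyFormulaZ2.Cruxes.ClusterSetConnected.Birth
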